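/-
Copyright (c) 2026 the pub-hodgecm-mathlib formalisation cell (harness21).  Prover seat hodgecm-mathlib-F0P2-p08 (g0) (L1; LEAD F0P6-plan (g14) BATCH #45 «S2 (law)»; S2 desk
K2Liu-p05 (g6) bytes (T2) 15:06:49Z): Track B «K2-LIT», hLiu418 = stmt-HodgeConjecture-24832, road `K2_Liu`, socket #42S, organ S2, road (γ), letter (law) — CONSUMER FORM.
-/
import Summits.HodgeConjecture.HodgeConjecture.Theorems.K2LiuArchSiegelCharacterTube   -- (law) (T1): `siegelDeltaCharacter_archPlace`, `isSiegelDelta_slice_of_toBlocks₂₁`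
import Summits.HodgeConjecture.HodgeConjecture.Theorems.K2LiuArchSWSpanningDefs          -- ★ S2 DEFS: `IsArchSiegelDeltaSection`
import HarnessLib

/-!
# Crux `HLiu418`, #42S organ S2, road (γ), letter (law) — CONSUMER FORM (desk (T2)): the one-place Siegel law of an arch Siegel section read through a tube chart

Cell `hodgecm-mathlib`, crux item hLiu418 = `stmt-HodgeConjecture-24832`; squad K2 ∕ K2Liu (L1, LEAD F0P6-plan (g14)); prover F0P2-p08 (g0); S2 desk K2Liu-p05 (g6).
THEOREMS ONLY (no `def`, no instance, no notation, no named-fact hypothesis, no `sorry`); lane `--supports stmt-HodgeConjecture-24832 --as helper`.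

THE LETTER (desk bytes (T2) = (T1) + `hA` + `update y w (a·b) = δ_w a · update y w b`).  For ANY arch Siegel section `A` of weight `(χ′, s′)` (★ `IsArchSiegelDeltaSection`), frozen
components `y = (y_{w′})_{w′}`, a tube chart `ιw : M_{2n}(ℂ) → U(σ_w J^𝔻)(ℂ)` at the complex place `w` inverting the tube image on `U(J)` (`τ (ιw P) = P`) and multiplicative on `U(J)`,
a tube-Siegel `p ∈ U(J)` (`p₂₁ = 0`) and `g ∈ U(J)`:
  `A(archPiEquivCM⁻¹ (y[w ↦ ιw (p g)])) = (conj z∕‖z‖)^{−t w} · ‖z‖^{2s′+n} · A(archPiEquivCM⁻¹ (y[w ↦ ιw g]))`,  `z = det p₁₁`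
— i.e. `g ↦ A(archPiEquivCM⁻¹ (y[w ↦ ιw g]))` is an arch Siegel section of the TUBE model (★ `K2LiuArchInducedTubeDefs.IsArchSiegelSection χ_k s′` ON `U(J)`, `χ_k z = (z̄∕|z|)^k`,
`k = −t w`) — the (lawv′) input of ★ `K2LiuArchSWSpanningInstance.archSWRegionSpanning_of_readings_on` (ED. 3) for the S2 packaging; with `χ′ := χ^{M₂}` (type `M₂ • t`) the weight is
`k_w = −M₂·t_w`.
* `update_eq_mulSingle_mul_update` — `y[w ↦ a·b] = δ_w a · y[w ↦ b]`; `tube_eq_of_chart_formula` — `hιτ` from ★ `exists_readingChart`'s matrix formula `hιM` + `T·Tinv = 1`;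
* **`apply_update_tube_mul`** — the consumer form above (frame `T = (D D; C −C)`, `Tinv·T = 1`, `D`, `C` invertible: the Shimura letters, ★ `isUnit_det_shimuraFrame`).
[Shimura1997, §16.4]; [Kudla1994, §3]; [HarrisKudlaSweet1996, §1 (1.15)]; [BorelJacquet1979, §4.1].
HONEST LABEL.  Count-neutral helper: `HC_CM` is proved only modulo the 7 printed citations (2 remaining named inputs: hLiu418 = `stmt-HodgeConjecture-24832`,
h413 = `stmt-HodgeConjecture-24833`) until rung 0 closes; this file closes no socket.
-/

set_option autoImplicit false
set_option linter.dupNamespace false -- the mandated namespace repeats `HodgeConjecture.HodgeConjecture`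

noncomputable section

open scoped Classical Matrix ComplexConjugate
open NumberField NumberField.InfinitePlace NumberField.mixedEmbedding IsDedekindDomain
open Literature.NumberTheory.Automorphic Literature.NumberTheory.Automorphic.UnitaryGroup
open Literature.NumberTheory.GaloisRepresentations
open Literature.NumberTheory.GelbartRogawski1991 Literature.NumberTheory.GelbartRogawski1991.GRConstruction
open Literature.NumberTheory.GelbartRogawski1991.UnitaryDualPair
open Literature.NumberTheory.K2Lit.SiegelDoubled
open Summit.HodgeConjecture.HodgeConjecture.Cruxes.HLiu418.K2LiuArchSWSpanningDefs (IsArchSiegelDeltaSection)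
open Summit.HodgeConjecture.HodgeConjecture.Cruxes.HLiu418.K2LiuArchSiegelCharacterTube

namespace Summit.HodgeConjecture.HodgeConjecture.Cruxes.HLiu418.K2LiuArchSiegelCharacterTubeConsumer

variable (L : Type) [Field L] [NumberField L] [IsCMField L]
variable {N M n : ℕ} (e : Fin N × Fin M ≃ Fin n)
  (dV : Fin N → L) (hdV : ∀ i, IsCMField.complexConj L (dV i) = dV i)
  (dW : Fin M → L) (hdW : ∀ i, IsCMField.complexConj L (dW i) = dW i)
  (w : {w : InfinitePlace L // w.IsComplex})

/-- `y[w ↦ a·b] = δ_w a · y[w ↦ b]` in a product of groups. [folklore] -/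
theorem update_eq_mulSingle_mul_update {ι : Type*} [DecidableEq ι] {G : ι → Type*} [∀ i, Group (G i)] (y : ∀ i, G i) (i : ι) (a b : G i) :
    Function.update y i (a * b) = Pi.mulSingle i a * Function.update y i b := by
  funext j
  by_cases hj : j = i
  · subst hj
    rw [Pi.mul_apply, Function.update_self, Function.update_self, Pi.mulSingle_eq_same]
  · rw [Pi.mul_apply, Function.update_of_ne hj, Function.update_of_ne hj, Pi.mulSingle_eq_of_ne hj, one_mul]

/-- **`hιτ` FROM THE CHART'S MATRIX FORMULA**: if the chart reads `↑(ιw P) = reindex e₂ e₂ (Tinv · P · T)` (★ `K2LiuArchReadingChart.exists_readingChart`'s `hιM`) and `T · Tinv = 1`,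
then the tube image of `ιw P` is `P`. [cite: Shimura1997, §6.5] -/
theorem tube_eq_of_chart_formula (T Tinv : Matrix (Fin n ⊕ Fin n) (Fin n ⊕ Fin n) ℂ) (h1 : T * Tinv = 1) {G : Matrix (Fin (n + n)) (Fin (n + n)) ℂ}
    {P : Matrix (Fin n ⊕ Fin n) (Fin n ⊕ Fin n) ℂ} (hG : G = Matrix.reindex (e₂ (n := n)) (e₂ (n := n)) (Tinv * P * T)) :
    T * Matrix.reindex (e₂ (n := n)).symm (e₂ (n := n)).symm G * Tinv = P := by
  rw [hG, ← Matrix.reindex_symm, Equiv.symm_apply_apply]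
  calc T * (Tinv * P * T) * Tinv = (T * Tinv) * P * (T * Tinv) := by simp only [Matrix.mul_assoc]
    _ = P := by rw [h1, Matrix.one_mul, Matrix.mul_one]

/-- **(law), CONSUMER FORM (desk (T2)).**  `A` an arch Siegel section of weight `(χ′, s′)` (★ `IsArchSiegelDeltaSection`), `χ′` of unitary archimedean type `(t, 0)`; the frame
`T = (D D; C −C)`, `Tinv·T = 1`, `D`, `C` invertible; a tube chart `ιw` at `w` with `τ (ιw P) = P` and `ιw (P Q) = ιw P · ιw Q` on `U(J)`; frozen components `y`; `p, g ∈ U(J)` with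
`p₂₁ = 0`.  Then `A(archPiEquivCM⁻¹ (y[w ↦ ιw (p g)])) = (conj z∕‖z‖)^{−t w} · ‖z‖^{2s′+n} · A(archPiEquivCM⁻¹ (y[w ↦ ιw g]))`, `z = det p₁₁`.
[cite: Shimura1997, §16.4] [cite: Kudla1994, §3] [cite: HarrisKudlaSweet1996, §1 (1.15)] [cite: BorelJacquet1979, §4.1] -/
theorem apply_update_tube_mul (D C : Matrix (Fin n) (Fin n) ℂ) (Tinv : Matrix (Fin n ⊕ Fin n) (Fin n ⊕ Fin n) ℂ)
    (hinv : Tinv * Matrix.fromBlocks D D C (-C) = 1) (hD : IsUnit D.det) (hC : IsUnit C.det)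
    (ιw : Matrix (Fin n ⊕ Fin n) (Fin n ⊕ Fin n) ℂ → archLocal L (n + n) (hermD L e dV hdV dW hdW) w)
    (hιτ : ∀ P : Matrix (Fin n ⊕ Fin n) (Fin n ⊕ Fin n) ℂ, Pᴴ * Matrix.J (Fin n) ℂ * P = Matrix.J (Fin n) ℂ →
      Matrix.fromBlocks D D C (-C) * Matrix.reindex (e₂ (n := n)).symm (e₂ (n := n)).symm ((ιw P : GL (Fin (n + n)) ℂ) : Matrix (Fin (n + n)) (Fin (n + n)) ℂ) * Tinv = P)
    (hιmul : ∀ P Q : Matrix (Fin n ⊕ Fin n) (Fin n ⊕ Fin n) ℂ, Pᴴ * Matrix.J (Fin n) ℂ * P = Matrix.J (Fin n) ℂ → Qᴴ * Matrix.J (Fin n) ℂ * Q = Matrix.J (Fin n) ℂ →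
      ιw (P * Q) = ιw P * ιw Q)
    {χ' : HeckeCharacter L} {t : InfinitePlace L → ℤ} (ht : χ'.HasUnitaryArchType t 0) {s' : ℂ}
    {A : arch (Fp L) L (IsCMField.complexConj L) (n + n) (hermD L e dV hdV dW hdW) → ℂ} (hA : IsArchSiegelDeltaSection L e dV hdV dW hdW χ' s' A)
    (y : ∀ w' : {w : InfinitePlace L // w.IsComplex}, archLocal L (n + n) (hermD L e dV hdV dW hdW) w')
    (p g : Matrix (Fin n ⊕ Fin n) (Fin n ⊕ Fin n) ℂ) (hp : pᴴ * Matrix.J (Fin n) ℂ * p = Matrix.J (Fin n) ℂ) (hp21 : p.toBlocks₂₁ = 0)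
    (hg : gᴴ * Matrix.J (Fin n) ℂ * g = Matrix.J (Fin n) ℂ) :
    A ((archPiEquivCM (n + n) L (hermD L e dV hdV dW hdW)).symm (Function.update y w (ιw (p * g)))) =
      (fun z : ℂ => (conj z / ((‖z‖ : ℝ) : ℂ)) ^ (-(t w.1))) p.toBlocks₁₁.det * (((‖p.toBlocks₁₁.det‖ : ℝ) : ℂ)) ^ (2 * s' + (n : ℂ)) *
        A ((archPiEquivCM (n + n) L (hermD L e dV hdV dW hdW)).symm (Function.update y w (ιw g))) := by
  have hPτ := hιτ p hp
  have hP21 : (Matrix.fromBlocks D D C (-C) * Matrix.reindex (e₂ (n := n)).symm (e₂ (n := n)).symm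
      ((ιw p : GL (Fin (n + n)) ℂ) : Matrix (Fin (n + n)) (Fin (n + n)) ℂ) * Tinv).toBlocks₂₁ = 0 := by
    rw [hPτ]
    exact hp21
  have hS := isSiegelDelta_slice_of_toBlocks₂₁ L e dV hdV dW hdW w D C Tinv hinv hC (ιw p) hP21
  have hchar := siegelDeltaCharacter_archPlace L e dV hdV dW hdW w D C Tinv hinv hD hC (ιw p) hP21 ht s'
  rw [hPτ] at hchar
  rw [hιmul p g hp hg, update_eq_mulSingle_mul_update, map_mul, hA _ hS, hchar]

end Summit.HodgeConjecture.HodgeConjecture.Cruxes.HLiu418.K2LiuArchSiegelCharacterTubeConsumer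

end
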